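/-
Copyright: the b2b-balaban T⁴-continuum CRUX team, row NE7b OWNER lineage `t4-ne7b-p1` (gen 139). Project licence.
-/
import Mathlib.Data.List.Induction
import Mathlib.Analysis.SpecificLimits.Basic

/-!
# DOBRUSHIN'S MASS TRANSPORT — the combinatorial half of the covariance kernel letter (SCOPING (d10)(2)): along a sequence of
# single-site resamplings `x₁, x₂, …` the coordinate-Lipschitz vector `v` of an observable is majorised by the dynamics
#   `(A_x v)_z = v_z + C_{xz}·v_x (z ≠ x)`, `(A_x v)_x = 0`   (`C ≥ 0`, `C_{xx} = 0`: Dobrushin's interdependence matrix),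
# i.e. the mass at the resampled site is removed and the fraction `C_{xz}` of it is handed to every other site. With `m_k(w)` the
# PRE-UPDATE MASS accumulated at `w` (the sum over the updates of `w` of the mass found there), the EXACT INVARIANT
#   `v_k + (I − Cᵀ)·m_k = v_0`
# holds, and for ANY nonnegative matrix `D` with `I + D·C ≤ D` entrywise (e.g. `D = Σ_n C^n` when the rows of `C` sum to `≤ γ < 1`)
#   `m_k ≤ Dᵀv_0`,  `v_k ≤ Dᵀv_0`,  `Σ_k v^a_{k−1}(x_k)·v^b_{k−1}(x_k)∕c_{x_k} ≤ Σ_w (Dᵀa)_w·(Dᵀb)_w∕c_w`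
# (two initial vectors `a, b ≥ 0`, floors `c > 0`), and a sweep through all sites contracts the total mass by the row-sum letter `γ`
# (row NE7b, node U5c; Mathlib only; [folklore] — Dobrushin 1968∕70, Föllmer 1982, in the Gibbs-sampler form)

Cell `pub-balaban`, sub-cell `t4`, spine estimate NE7b (`T4WeightBudget.RelWeightBound`; the cell's OWN estimate — NOT PRINTED in
[Bałaban 1983–89], NOT PROVED).  Crux-route work under `Spine/NE7b/` by the row OWNER (`t4-ne7b-p1` gen 139, file (440)) under FREEZE
(0)'s crux-prover clause; NOTHING of Bałaban's is named as a Lean object, valued or asserted; no `T4Continuum/Support` leaf typed; no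
`def`, no notation (the update maps `A`, `Φ`, `Ψ` are hypothesis-characterised variables); zero `sorry`.  Imports: Mathlib only (fast lane).

WHY (located, SCOPING-d10 (2)).  (439) reduced the output Hessian's kernel letter to the row sums of the tilted COVARIANCE kernel
`C_{xy}(ψ) = Cov_ν(∂_xU, ∂_yU)`.  Form-sense Brascamp–Lieb gives no off-diagonal decay; the Helffer–Sjöstrand representation needs elliptic
theory the tree does not have.  The road taken instead is DOBRUSHIN'S: under row-diagonal dominance of the Hessian kernel of the total
potential `V` (`Σ_{z≠x} sup|∂_x∂_zV| ≤ γ·inf ∂_x²V`), the single-site Gibbs sampler `P_x` (resample `ω_x` from its conditional law) maps an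
observable with coordinate-Lipschitz vector `v` to one with vector `≤ A_x v` (`C_{xz} = sup|∂_x∂_zV|∕inf ∂_x²V`), is `ν`-invariant, and loses
at most `v^F_x·v^G_x∕c_x` of covariance per step; telescoping along infinitely many sweeps gives Föllmer's covariance estimate
`|Cov_ν(F,G)| ≤ Σ_w (Dᵀa)_w(Dᵀb)_w∕c_w` [Föllmer, Saint-Flour XV–XVII, LNM 1362, Thm (2.13)∕(2.23); J. Funct. Anal. 46 (1982)] — in KERNEL
LETTERS (row sums multiply), uniformly in the volume.  THIS FILE is the measure-free bookkeeping of that argument; the class, the abstract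
assembly, the one-dimensional letters and the Gibbs sampler are the next files (441)–(446).

WHAT IS PROVED ([folklore]; `C D : ι → ι → ℝ`, `c : ι → ℝ`, update maps characterised by `hA`, `hΦ`, `hΨ`; folds `List.foldl` over the
update sequence `xs`):
* §1 one step: `step_apply_self`, `step_apply_ne`, `step_nonneg`, `step_sum` (`Σ_z(A_xv)_z = Σ_zv_z − (1 − Σ_zC_{xz})v_x`), `step_mono`.
* §2 the trajectory with its pre-update mass (`Φ_x(v,m) = (A_xv, m + v_x·e_x)`): `traj_fst` (the first component is the plain fold),
  `traj_nonneg`, **`traj_invariant`** (`v_k(w) + m_k(w) − Σ_z C_{zw}m_k(z) = v_0(w) + m_0(w) − Σ_z C_{zw}m_0(z)`), **`mass_le`** (`m_k ≤ Dᵀv_0`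
  from `m_0 = 0`), **`osc_le`** (`v_k ≤ Dᵀv_0`).
* §3 the bilinear pre-update sum (`Ψ_x(u,v,S) = (A_xu, A_xv, S + u_x·v_x∕c_x)`): `bisum_fst`, `bisum_snd`, `bisum_le_mass`, **`bisum_le`**
  (`S_k ≤ Σ_w (Dᵀa)_w(Dᵀb)_w∕c_w`).
* §4 sweeps: `sweep_total_le` (a list visiting every site: `Σ_w v_end(w) ≤ γ·Σ_w v_0(w)` when `Σ_z C_{xz} ≤ γ ≤ 1`), `sweeps_total_le`
  (`k` sweeps: `γ^k`), `sweeps_total_tendsto_zero` (`γ < 1`).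
* §5 toy (kernel): two sites, `C_{01} = C_{10} = ½`, one update of site `0` sends `(1,0) ↦ (0,½)`.

HONEST (what this is NOT).  Pure bookkeeping of nonnegative vectors; no measure, no potential.  That the Gibbs sampler realises these
hypotheses (Lipschitz propagation with `C_{xz} = sup|∂_x∂_zV|∕c_x`, invariance, the one-step covariance loss `≤ a_xb_x∕c_x`) is (443)–(446);
the road instance (the tilted law of (399)–(439), `V = ½ω·Γ⁻¹ω + U(ω+ψ)`) is (447).  Scalar skeleton ((A3), NC-NE7b-α UNRULED); nothing of
Bałaban's asserted.  BY-NAME EFFECT ON THE WALL: NONE.  NE7b NOT PRINTED ∕ NOT PROVED; spine PROVED 0∕9; rung (B)+1 — the programme's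
measures remain FINITE-torus statements; NOT the mass gap, NOT Clay.  HONEST DEPENDENCY: continuum YM on T⁴ ⇐ BetaPertH ∧ nine spine
estimates (0∕9 proved); BetaPertH ⇐ (D1) ∧ (D4) ∧ CAP+tail; G-an2-4 gates asym, D1 and NE2∕3∕4.
-/

set_option autoImplicit false

namespace Summit.QuantumFields.BalabanUV.T4Continuum.NE7b.SupDobrushinMassTransport

open Finset Filter Topology
open scoped BigOperators

variable {ι : Type} [Fintype ι] [DecidableEq ι]

variable {C D : ι → ι → ℝ} {c : ι → ℝ} {γ : ℝ} {A : ι → (ι → ℝ) → (ι → ℝ)}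
  {Φ : ι → (ι → ℝ) × (ι → ℝ) → (ι → ℝ) × (ι → ℝ)} {Ψ : ι → (ι → ℝ) × (ι → ℝ) × ℝ → (ι → ℝ) × (ι → ℝ) × ℝ}

/-! ## §1. One update -/

omit [Fintype ι] in
/-- The resampled site carries no mass after the update. [folklore] -/
theorem step_apply_self (hA : ∀ x v z, A x v z = if z = x then 0 else v z + C x z * v x) (x : ι) (v : ι → ℝ) : A x v x = 0 := by
  rw [hA]; simp

omit [Fintype ι] in
/-- Every other site receives the fraction `C_{xz}` of the removed mass. [folklore] -/
theorem step_apply_ne (hA : ∀ x v z, A x v z = if z = x then 0 else v z + C x z * v x) (x : ι) (v : ι → ℝ) {z : ι} (hz : z ≠ x) :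
    A x v z = v z + C x z * v x := by
  rw [hA]; simp [hz]

omit [Fintype ι] in
/-- The update preserves nonnegativity (`C ≥ 0`). [folklore] -/
theorem step_nonneg (hA : ∀ x v z, A x v z = if z = x then 0 else v z + C x z * v x) (hC : ∀ x z, 0 ≤ C x z) (x : ι) {v : ι → ℝ}
    (hv : ∀ z, 0 ≤ v z) (z : ι) : 0 ≤ A x v z := by
  rw [hA]
  split_ifs
  · exact le_rfl
  · exact add_nonneg (hv z) (mul_nonneg (hC x z) (hv x))

/-- **The total mass after one update**: `Σ_z (A_xv)_z = Σ_z v_z − (1 − Σ_z C_{xz})·v_x` (`C_{xx} = 0`). [folklore] -/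
theorem step_sum (hA : ∀ x v z, A x v z = if z = x then 0 else v z + C x z * v x) (hC0 : ∀ x, C x x = 0) (x : ι) (v : ι → ℝ) :
    ∑ z, A x v z = ∑ z, v z - (1 - ∑ z, C x z) * v x := by
  have h : ∀ z, A x v z = (v z + C x z * v x) - (if z = x then v x else 0) := by
    intro z
    rw [hA]
    split_ifs with hz
    · subst hz; rw [hC0]; ring
    · ring
  simp_rw [h]
  rw [Finset.sum_sub_distrib, Finset.sum_add_distrib, Finset.sum_ite_eq' Finset.univ x, if_pos (Finset.mem_univ x), ← Finset.sum_mul]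
  ring

omit [Fintype ι] in
/-- The update is monotone (`C ≥ 0`). [folklore] -/
theorem step_mono (hA : ∀ x v z, A x v z = if z = x then 0 else v z + C x z * v x) (hC : ∀ x z, 0 ≤ C x z) (x : ι) {v w : ι → ℝ}
    (hvw : ∀ z, v z ≤ w z) (z : ι) : A x v z ≤ A x w z := by
  rw [hA, hA]
  split_ifs
  · exact le_rfl
  · exact add_le_add (hvw z) (mul_le_mul_of_nonneg_left (hvw x) (hC x z))

/-! ## §2. The trajectory and its pre-update mass -/

omit [Fintype ι] in
/-- The first component of the `(v, m)`-trajectory is the plain fold of the update. [folklore] -/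
theorem traj_fst (hΦ : ∀ x p, Φ x p = (A x p.1, fun z => if z = x then p.2 z + p.1 x else p.2 z)) (xs : List ι) (v₀ m₀ : ι → ℝ) :
    (xs.foldl (fun p x => Φ x p) (v₀, m₀)).1 = xs.foldl (fun v x => A x v) v₀ := by
  induction xs using List.reverseRecOn generalizing v₀ m₀ with
  | nil => rfl
  | append_singleton xs x ih =>
    rw [List.foldl_append, List.foldl_append, List.foldl_cons, List.foldl_nil, List.foldl_cons, List.foldl_nil, hΦ, ih]

omit [Fintype ι] in
/-- Both components stay nonnegative (`C ≥ 0`, nonnegative start). [folklore] -/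
theorem traj_nonneg (hA : ∀ x v z, A x v z = if z = x then 0 else v z + C x z * v x)
    (hΦ : ∀ x p, Φ x p = (A x p.1, fun z => if z = x then p.2 z + p.1 x else p.2 z)) (hC : ∀ x z, 0 ≤ C x z) (xs : List ι)
    {v₀ m₀ : ι → ℝ} (hv₀ : ∀ z, 0 ≤ v₀ z) (hm₀ : ∀ z, 0 ≤ m₀ z) (z : ι) :
    0 ≤ (xs.foldl (fun p x => Φ x p) (v₀, m₀)).1 z ∧ 0 ≤ (xs.foldl (fun p x => Φ x p) (v₀, m₀)).2 z := by
  induction xs using List.reverseRecOn generalizing z with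
  | nil => exact ⟨hv₀ z, hm₀ z⟩
  | append_singleton xs x ih =>
    rw [List.foldl_append, List.foldl_cons, List.foldl_nil, hΦ]
    refine ⟨step_nonneg hA hC x (fun w => (ih w).1) z, ?_⟩
    dsimp only
    split_ifs
    · exact add_nonneg (ih z).2 (ih x).1
    · exact (ih z).2

/-- **THE EXACT INVARIANT `v_k + (I − Cᵀ)m_k = v_0 + (I − Cᵀ)m_0`** (`C_{xx} = 0`): for every `w`,
`v_k(w) + m_k(w) − Σ_z C_{zw}m_k(z) = v_0(w) + m_0(w) − Σ_z C_{zw}m_0(z)`. [folklore] -/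
theorem traj_invariant (hA : ∀ x v z, A x v z = if z = x then 0 else v z + C x z * v x)
    (hΦ : ∀ x p, Φ x p = (A x p.1, fun z => if z = x then p.2 z + p.1 x else p.2 z)) (hC0 : ∀ x, C x x = 0) (xs : List ι)
    (v₀ m₀ : ι → ℝ) (w : ι) :
    (xs.foldl (fun p x => Φ x p) (v₀, m₀)).1 w + (xs.foldl (fun p x => Φ x p) (v₀, m₀)).2 w -
        ∑ z, C z w * (xs.foldl (fun p x => Φ x p) (v₀, m₀)).2 z =
      v₀ w + m₀ w - ∑ z, C z w * m₀ z := by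
  induction xs using List.reverseRecOn generalizing w with
  | nil => rfl
  | append_singleton xs x ih =>
    rw [List.foldl_append, List.foldl_cons, List.foldl_nil, hΦ, ← ih w]
    set p := xs.foldl (fun p x => Φ x p) (v₀, m₀) with hp
    dsimp only
    -- the new mass vector differs from the old one only at `x`
    have hsum : ∑ z, C z w * (if z = x then p.2 z + p.1 x else p.2 z) = ∑ z, C z w * p.2 z + C x w * p.1 x := by
      have h : ∀ z, C z w * (if z = x then p.2 z + p.1 x else p.2 z) = C z w * p.2 z + (if z = x then C x w * p.1 x else 0) := by
        intro z
        split_ifs with hz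
        · subst hz; ring
        · ring
      simp_rw [h]
      rw [Finset.sum_add_distrib, Finset.sum_ite_eq' Finset.univ x, if_pos (Finset.mem_univ x)]
    rw [hsum, hA]
    split_ifs with hw
    · subst hw; rw [hC0]; ring
    · ring

/-- **THE PRE-UPDATE MASS IS DOMINATED, `m_k ≤ Dᵀv_0`**, for every nonnegative `D` with `I + D·C ≤ D` (start `m_0 = 0`, `v_0 ≥ 0`):
`m_k(w) ≤ Σ_z D_{zw}v_0(z)`. (At the update of `x` the accumulated mass there becomes `v_0(x) + (Cᵀm)(x)`, by the invariant.) [folklore] -/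
theorem mass_le (hA : ∀ x v z, A x v z = if z = x then 0 else v z + C x z * v x)
    (hΦ : ∀ x p, Φ x p = (A x p.1, fun z => if z = x then p.2 z + p.1 x else p.2 z)) (hC : ∀ x z, 0 ≤ C x z) (hC0 : ∀ x, C x x = 0)
    (hD : ∀ x y, 0 ≤ D x y) (hDC : ∀ x y, (if x = y then (1 : ℝ) else 0) + ∑ z, D x z * C z y ≤ D x y) (xs : List ι) {v₀ : ι → ℝ}
    (hv₀ : ∀ z, 0 ≤ v₀ z) (w : ι) :
    (xs.foldl (fun p x => Φ x p) (v₀, 0)).2 w ≤ ∑ z, D z w * v₀ z := by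
  induction xs using List.reverseRecOn generalizing w with
  | nil => exact Finset.sum_nonneg fun z _ => mul_nonneg (hD z w) (hv₀ z)
  | append_singleton xs x ih =>
    have hinv := traj_invariant hA hΦ hC0 xs v₀ 0 x
    simp only [Pi.zero_apply, mul_zero, Finset.sum_const_zero, sub_zero, add_zero] at hinv
    rw [List.foldl_append, List.foldl_cons, List.foldl_nil, hΦ]
    set p := xs.foldl (fun p x => Φ x p) (v₀, 0) with hp
    dsimp only
    split_ifs with hw
    · subst hw
      -- `m(w) + v(w) = v₀(w) + Σ_z C_{zw} m(z) ≤ v₀(w) + Σ_z C_{zw}(Dᵀv₀)(z) ≤ (Dᵀv₀)(w)`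
      have h1 : p.2 w + p.1 w = v₀ w + ∑ z, C z w * p.2 z := by linarith
      rw [h1]
      calc v₀ w + ∑ z, C z w * p.2 z ≤ v₀ w + ∑ z, C z w * ∑ y, D y z * v₀ y :=
            add_le_add le_rfl (Finset.sum_le_sum fun z _ => mul_le_mul_of_nonneg_left (ih z) (hC z w))
        _ = ∑ y, v₀ y * ((if y = w then (1 : ℝ) else 0) + ∑ z, D y z * C z w) := by
            simp_rw [mul_add, Finset.mul_sum]
            rw [Finset.sum_add_distrib]
            congr 1
            · simp
            · rw [Finset.sum_comm]
              exact Finset.sum_congr rfl fun z _ => Finset.sum_congr rfl fun y _ => by ring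
        _ ≤ ∑ y, v₀ y * D y w := Finset.sum_le_sum fun y _ => mul_le_mul_of_nonneg_left (hDC y w) (hv₀ y)
        _ = ∑ z, D z w * v₀ z := Finset.sum_congr rfl fun z _ => mul_comm _ _
    · exact ih w

/-- **THE TRAJECTORY IS DOMINATED, `v_k ≤ Dᵀv_0`**: `v_k(w) ≤ Σ_z D_{zw}v_0(z)` (from the invariant, `m_k ≥ 0` and `mass_le`). [folklore] -/
theorem osc_le (hA : ∀ x v z, A x v z = if z = x then 0 else v z + C x z * v x)
    (hΦ : ∀ x p, Φ x p = (A x p.1, fun z => if z = x then p.2 z + p.1 x else p.2 z)) (hC : ∀ x z, 0 ≤ C x z) (hC0 : ∀ x, C x x = 0)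
    (hD : ∀ x y, 0 ≤ D x y) (hDC : ∀ x y, (if x = y then (1 : ℝ) else 0) + ∑ z, D x z * C z y ≤ D x y) (xs : List ι) {v₀ : ι → ℝ}
    (hv₀ : ∀ z, 0 ≤ v₀ z) (w : ι) :
    xs.foldl (fun v x => A x v) v₀ w ≤ ∑ z, D z w * v₀ z := by
  rw [← traj_fst hΦ xs v₀ 0]
  have hinv := traj_invariant hA hΦ hC0 xs v₀ 0 w
  simp only [Pi.zero_apply, mul_zero, Finset.sum_const_zero, sub_zero, add_zero] at hinv
  set p := xs.foldl (fun p x => Φ x p) (v₀, 0) with hp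
  have hm0 : 0 ≤ p.2 w := (traj_nonneg hA hΦ hC xs hv₀ (fun _ => le_rfl) w).2
  have hm : ∀ z, p.2 z ≤ ∑ y, D y z * v₀ y := fun z => mass_le hA hΦ hC hC0 hD hDC xs hv₀ z
  have h1 : p.1 w ≤ v₀ w + ∑ z, C z w * p.2 z := by linarith
  calc p.1 w ≤ v₀ w + ∑ z, C z w * p.2 z := h1
    _ ≤ v₀ w + ∑ z, C z w * ∑ y, D y z * v₀ y :=
        add_le_add le_rfl (Finset.sum_le_sum fun z _ => mul_le_mul_of_nonneg_left (hm z) (hC z w))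
    _ = ∑ y, v₀ y * ((if y = w then (1 : ℝ) else 0) + ∑ z, D y z * C z w) := by
        simp_rw [mul_add, Finset.mul_sum]
        rw [Finset.sum_add_distrib]
        congr 1
        · simp
        · rw [Finset.sum_comm]
          exact Finset.sum_congr rfl fun z _ => Finset.sum_congr rfl fun y _ => by ring
    _ ≤ ∑ y, v₀ y * D y w := Finset.sum_le_sum fun y _ => mul_le_mul_of_nonneg_left (hDC y w) (hv₀ y)
    _ = ∑ z, D z w * v₀ z := Finset.sum_congr rfl fun z _ => mul_comm _ _

/-! ## §3. The bilinear pre-update sum -/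

omit [Fintype ι] [DecidableEq ι] in
/-- The first vector of the triple fold is the plain fold of the first start. [folklore] -/
theorem bisum_fst (hΨ : ∀ x q, Ψ x q = (A x q.1, A x q.2.1, q.2.2 + q.1 x * q.2.1 x / c x)) (xs : List ι) (a b : ι → ℝ) (S₀ : ℝ) :
    (xs.foldl (fun q x => Ψ x q) (a, b, S₀)).1 = xs.foldl (fun v x => A x v) a := by
  induction xs using List.reverseRecOn with
  | nil => rfl
  | append_singleton xs x ih =>
    rw [List.foldl_append, List.foldl_append, List.foldl_cons, List.foldl_nil, List.foldl_cons, List.foldl_nil, hΨ, ih]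

omit [Fintype ι] [DecidableEq ι] in
/-- The second vector of the triple fold is the plain fold of the second start. [folklore] -/
theorem bisum_snd (hΨ : ∀ x q, Ψ x q = (A x q.1, A x q.2.1, q.2.2 + q.1 x * q.2.1 x / c x)) (xs : List ι) (a b : ι → ℝ) (S₀ : ℝ) :
    (xs.foldl (fun q x => Ψ x q) (a, b, S₀)).2.1 = xs.foldl (fun v x => A x v) b := by
  induction xs using List.reverseRecOn with
  | nil => rfl
  | append_singleton xs x ih =>
    rw [List.foldl_append, List.foldl_append, List.foldl_cons, List.foldl_nil, List.foldl_cons, List.foldl_nil, hΨ, ih]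

/-- **The bilinear sum against the accumulated mass**: `S_k ≤ Σ_w m^a_k(w)·(Dᵀb)_w∕c_w` (each new term `v^a(x)v^b(x)∕c_x` is at most
`v^a(x)(Dᵀb)_x∕c_x`, and `v^a(x)` is exactly what the `a`-mass accumulates at that update). [folklore] -/
theorem bisum_le_mass (hA : ∀ x v z, A x v z = if z = x then 0 else v z + C x z * v x)
    (hΦ : ∀ x p, Φ x p = (A x p.1, fun z => if z = x then p.2 z + p.1 x else p.2 z))
    (hΨ : ∀ x q, Ψ x q = (A x q.1, A x q.2.1, q.2.2 + q.1 x * q.2.1 x / c x)) (hC : ∀ x z, 0 ≤ C x z) (hC0 : ∀ x, C x x = 0)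
    (hD : ∀ x y, 0 ≤ D x y) (hDC : ∀ x y, (if x = y then (1 : ℝ) else 0) + ∑ z, D x z * C z y ≤ D x y) (hc : ∀ x, 0 < c x)
    (xs : List ι) {a b : ι → ℝ} (ha : ∀ z, 0 ≤ a z) (hb : ∀ z, 0 ≤ b z) :
    (xs.foldl (fun q x => Ψ x q) (a, b, 0)).2.2 ≤
      ∑ w, (xs.foldl (fun p x => Φ x p) (a, 0)).2 w * ((∑ z, D z w * b z) / c w) := by
  induction xs using List.reverseRecOn with
  | nil => simp
  | append_singleton xs x ih =>
    have hva : (xs.foldl (fun q x => Ψ x q) (a, b, 0)).1 = (xs.foldl (fun p x => Φ x p) (a, 0)).1 := by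
      rw [bisum_fst hΨ, traj_fst hΦ]
    have hvb : ∀ w, (xs.foldl (fun q x => Ψ x q) (a, b, 0)).2.1 w ≤ ∑ z, D z w * b z := fun w => by
      rw [bisum_snd hΨ]; exact osc_le hA hΦ hC hC0 hD hDC xs hb w
    have hva0 : ∀ w, 0 ≤ (xs.foldl (fun p x => Φ x p) (a, 0)).1 w := fun w =>
      (traj_nonneg hA hΦ hC xs ha (fun _ => le_rfl) w).1
    rw [List.foldl_append, List.foldl_cons, List.foldl_nil, hΨ, List.foldl_append, List.foldl_cons, List.foldl_nil, hΦ]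
    set q := xs.foldl (fun q x => Ψ x q) (a, b, 0) with hq
    set p := xs.foldl (fun p x => Φ x p) (a, 0) with hp
    dsimp only
    -- the new mass vector is `p.2 + p.1 x · e_x`
    have hsum : ∑ w, (if w = x then p.2 w + p.1 x else p.2 w) * ((∑ z, D z w * b z) / c w) =
        ∑ w, p.2 w * ((∑ z, D z w * b z) / c w) + p.1 x * ((∑ z, D z x * b z) / c x) := by
      have h : ∀ w, (if w = x then p.2 w + p.1 x else p.2 w) * ((∑ z, D z w * b z) / c w) =
          p.2 w * ((∑ z, D z w * b z) / c w) + (if w = x then p.1 x * ((∑ z, D z x * b z) / c x) else 0) := by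
        intro w
        split_ifs with hw
        · subst hw; ring
        · ring
      simp_rw [h]
      rw [Finset.sum_add_distrib, Finset.sum_ite_eq' Finset.univ x, if_pos (Finset.mem_univ x)]
    rw [hsum, hva]
    have hterm : p.1 x * q.2.1 x / c x ≤ p.1 x * ((∑ z, D z x * b z) / c x) := by
      rw [mul_div_assoc]
      exact mul_le_mul_of_nonneg_left (div_le_div_of_nonneg_right (hvb x) (hc x).le) (hva0 x)
    linarith

/-- **THE BILINEAR PRE-UPDATE SUM IS DOMINATED**: `Σ_k v^a_{k−1}(x_k)v^b_{k−1}(x_k)∕c_{x_k} ≤ Σ_w (Dᵀa)_w·(Dᵀb)_w∕c_w` for every update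
sequence, every nonnegative `D` with `I + D·C ≤ D`, nonnegative starts `a, b` and floors `c > 0` — this is the sum that bounds the
covariance telescoped along the Gibbs sampler. [folklore] -/
theorem bisum_le (hA : ∀ x v z, A x v z = if z = x then 0 else v z + C x z * v x)
    (hΨ : ∀ x q, Ψ x q = (A x q.1, A x q.2.1, q.2.2 + q.1 x * q.2.1 x / c x)) (hC : ∀ x z, 0 ≤ C x z) (hC0 : ∀ x, C x x = 0)
    (hD : ∀ x y, 0 ≤ D x y) (hDC : ∀ x y, (if x = y then (1 : ℝ) else 0) + ∑ z, D x z * C z y ≤ D x y) (hc : ∀ x, 0 < c x)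
    (xs : List ι) {a b : ι → ℝ} (ha : ∀ z, 0 ≤ a z) (hb : ∀ z, 0 ≤ b z) :
    (xs.foldl (fun q x => Ψ x q) (a, b, 0)).2.2 ≤ ∑ w, (∑ z, D z w * a z) * (∑ z, D z w * b z) / c w := by
  -- the `(v, m)`-update, written out once
  have hΦ : ∀ (x : ι) (p : (ι → ℝ) × (ι → ℝ)), (fun (x : ι) (p : (ι → ℝ) × (ι → ℝ)) =>
      ((A x p.1, fun z => if z = x then p.2 z + p.1 x else p.2 z) : (ι → ℝ) × (ι → ℝ))) x p =
      (A x p.1, fun z => if z = x then p.2 z + p.1 x else p.2 z) := fun _ _ => rfl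
  refine (bisum_le_mass hA hΦ hΨ hC hC0 hD hDC hc xs ha hb).trans ?_
  refine Finset.sum_le_sum fun w _ => ?_
  rw [mul_div_assoc]
  exact mul_le_mul_of_nonneg_right (mass_le hA hΦ hC hC0 hD hDC xs ha w)
    (div_nonneg (Finset.sum_nonneg fun z _ => mul_nonneg (hD z w) (hb z)) (hc w).le)

/-! ## §4. Sweeps contract the total mass -/

/-- Bookkeeping of a partial sweep: the total mass plus `(1−γ)` times the initial mass of the sites already visited never exceeds the
initial total, and a site not yet visited carries at least its initial mass. [folklore] -/
theorem sweep_prefix (hA : ∀ x v z, A x v z = if z = x then 0 else v z + C x z * v x) (hC : ∀ x z, 0 ≤ C x z) (hC0 : ∀ x, C x x = 0)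
    (hrow : ∀ x, ∑ z, C x z ≤ γ) (hγ1 : γ ≤ 1) (xs : List ι) {v₀ : ι → ℝ} (hv₀ : ∀ z, 0 ≤ v₀ z) :
    (∑ w, xs.foldl (fun v x => A x v) v₀ w + (1 - γ) * ∑ w ∈ xs.toFinset, v₀ w ≤ ∑ w, v₀ w) ∧
      ∀ w, w ∉ xs.toFinset → v₀ w ≤ xs.foldl (fun v x => A x v) v₀ w := by
  induction xs using List.reverseRecOn with
  | nil => simp
  | append_singleton xs x ih =>
    obtain ⟨ih1, ih2⟩ := ih
    set v := xs.foldl (fun v x => A x v) v₀ with hv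
    have hvnn : ∀ z, 0 ≤ v z := by
      intro z
      rw [hv, ← traj_fst (Φ := fun x p => (A x p.1, fun z => if z = x then p.2 z + p.1 x else p.2 z)) (fun _ _ => rfl) xs v₀ 0]
      exact (traj_nonneg hA (Φ := fun x p => (A x p.1, fun z => if z = x then p.2 z + p.1 x else p.2 z)) (fun _ _ => rfl) hC xs hv₀
        (fun _ => le_rfl) z).1
    rw [List.foldl_append, List.foldl_cons, List.foldl_nil, List.toFinset_append, List.toFinset_cons, List.toFinset_nil,
      insert_empty_eq]
    have htot : ∑ w, A x v w ≤ ∑ w, v w - (1 - γ) * v x := by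
      rw [step_sum hA hC0 x v]
      have : (1 - γ) * v x ≤ (1 - ∑ z, C x z) * v x := mul_le_mul_of_nonneg_right (by linarith [hrow x]) (hvnn x)
      linarith
    refine ⟨?_, fun w hw => ?_⟩
    · by_cases hx : x ∈ xs.toFinset
      · rw [Finset.union_eq_left.2 (Finset.singleton_subset_iff.2 hx)]
        have : 0 ≤ (1 - γ) * v x := mul_nonneg (by linarith) (hvnn x)
        linarith
      · rw [Finset.sum_union (Finset.disjoint_singleton_right.2 hx), Finset.sum_singleton]
        have hx' := ih2 x hx
        have : (1 - γ) * v₀ x ≤ (1 - γ) * v x := mul_le_mul_of_nonneg_left hx' (by linarith)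
        linarith
    · rw [Finset.mem_union, Finset.mem_singleton, not_or] at hw
      rw [step_apply_ne hA x v hw.2]
      exact (ih2 w hw.1).trans (le_add_of_nonneg_right (mul_nonneg (hC x w) (hvnn x)))

/-- **ONE SWEEP CONTRACTS THE TOTAL MASS BY `γ`**: if the update sequence visits every site (`∀ w, w ∈ xs`), `Σ_z C_{xz} ≤ γ ≤ 1`, then
`Σ_w v_end(w) ≤ γ·Σ_w v_0(w)`. [folklore] -/
theorem sweep_total_le (hA : ∀ x v z, A x v z = if z = x then 0 else v z + C x z * v x) (hC : ∀ x z, 0 ≤ C x z) (hC0 : ∀ x, C x x = 0)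
    (hrow : ∀ x, ∑ z, C x z ≤ γ) (hγ1 : γ ≤ 1) {xs : List ι} (hxs : ∀ w, w ∈ xs) {v₀ : ι → ℝ} (hv₀ : ∀ z, 0 ≤ v₀ z) :
    ∑ w, xs.foldl (fun v x => A x v) v₀ w ≤ γ * ∑ w, v₀ w := by
  have h := (sweep_prefix hA hC hC0 hrow hγ1 xs hv₀).1
  have hall : xs.toFinset = Finset.univ := Finset.eq_univ_iff_forall.2 fun w => List.mem_toFinset.2 (hxs w)
  rw [hall] at h
  linarith

/-- **`k` SWEEPS CONTRACT BY `γ^k`**. [folklore] -/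
theorem sweeps_total_le (hA : ∀ x v z, A x v z = if z = x then 0 else v z + C x z * v x) (hC : ∀ x z, 0 ≤ C x z) (hC0 : ∀ x, C x x = 0)
    (hrow : ∀ x, ∑ z, C x z ≤ γ) (hγ1 : γ ≤ 1) {xs : List ι} (hxs : ∀ w, w ∈ xs) {v₀ : ι → ℝ} (hv₀ : ∀ z, 0 ≤ v₀ z) (k : ℕ) :
    ∑ w, (List.replicate k xs).flatten.foldl (fun v x => A x v) v₀ w ≤ γ ^ k * ∑ w, v₀ w := by
  induction k with
  | zero => simp
  | succ k ih =>
    rw [List.replicate_succ', List.flatten_append, List.flatten_singleton, List.foldl_append, pow_succ]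
    set v := (List.replicate k xs).flatten.foldl (fun v x => A x v) v₀ with hv
    have hvnn : ∀ z, 0 ≤ v z := by
      intro z
      rw [hv, ← traj_fst (Φ := fun x p => (A x p.1, fun z => if z = x then p.2 z + p.1 x else p.2 z)) (fun _ _ => rfl) _ v₀ 0]
      exact (traj_nonneg hA (Φ := fun x p => (A x p.1, fun z => if z = x then p.2 z + p.1 x else p.2 z)) (fun _ _ => rfl) hC _ hv₀
        (fun _ => le_rfl) z).1
    rcases isEmpty_or_nonempty ι with hι | ⟨⟨x⟩⟩
    · simp
    have hγ0 : 0 ≤ γ := (Finset.sum_nonneg fun z _ => hC x z).trans (hrow x)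
    calc ∑ w, xs.foldl (fun v x => A x v) v w ≤ γ * ∑ w, v w := sweep_total_le hA hC hC0 hrow hγ1 hxs hvnn
      _ ≤ γ * (γ ^ k * ∑ w, v₀ w) := mul_le_mul_of_nonneg_left ih hγ0
      _ = γ ^ k * γ * ∑ w, v₀ w := by ring

/-- **THE TOTAL MASS TENDS TO ZERO ALONG THE SWEEPS** (`0 ≤ γ < 1`). [folklore] -/
theorem sweeps_total_tendsto_zero (hA : ∀ x v z, A x v z = if z = x then 0 else v z + C x z * v x) (hC : ∀ x z, 0 ≤ C x z)
    (hC0 : ∀ x, C x x = 0) (hrow : ∀ x, ∑ z, C x z ≤ γ) (hγ0 : 0 ≤ γ) (hγ1 : γ < 1) {xs : List ι} (hxs : ∀ w, w ∈ xs) {v₀ : ι → ℝ}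
    (hv₀ : ∀ z, 0 ≤ v₀ z) :
    Tendsto (fun k : ℕ => ∑ w, (List.replicate k xs).flatten.foldl (fun v x => A x v) v₀ w) atTop (𝓝 0) := by
  have hup : ∀ k, ∑ w, (List.replicate k xs).flatten.foldl (fun v x => A x v) v₀ w ≤ γ ^ k * ∑ w, v₀ w := fun k =>
    sweeps_total_le hA hC hC0 hrow hγ1.le hxs hv₀ k
  have hlo : ∀ k, 0 ≤ ∑ w, (List.replicate k xs).flatten.foldl (fun v x => A x v) v₀ w := by
    intro k
    refine Finset.sum_nonneg fun z _ => ?_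
    rw [← traj_fst (Φ := fun x p => (A x p.1, fun z => if z = x then p.2 z + p.1 x else p.2 z)) (fun _ _ => rfl) _ v₀ 0]
    exact (traj_nonneg hA (Φ := fun x p => (A x p.1, fun z => if z = x then p.2 z + p.1 x else p.2 z)) (fun _ _ => rfl) hC _ hv₀
      (fun _ => le_rfl) z).1
  have hlim : Tendsto (fun k : ℕ => γ ^ k * ∑ w, v₀ w) atTop (𝓝 0) := by
    simpa using (tendsto_pow_atTop_nhds_zero_of_lt_one hγ0 hγ1).mul_const (∑ w, v₀ w)
  exact squeeze_zero hlo hup hlim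

/-! ## §5. Toy instance (kernel) -/

/-- Toy: two sites `Fin 2`, `C_{01} = C_{10} = ½`, `C_{00} = C_{11} = 0`; one update of site `0` applied to `v = (1, 0)` gives `(0, ½)`:
the mass at the resampled site is removed and half of it is handed to the other site. -/
example : (fun (x : Fin 2) (v : Fin 2 → ℝ) (z : Fin 2) => if z = x then (0 : ℝ) else v z + (if x = z then (0 : ℝ) else 1 / 2) * v x) 0
    (fun z => if z = 0 then 1 else 0) = fun z => if z = 0 then 0 else 1 / 2 := by
  funext z
  fin_cases z <;> simp

end Summit.QuantumFields.BalabanUV.T4Continuum.NE7b.SupDobrushinMassTransport
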